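import Literature.MathematicalPhysics.QuantumFieldTheory.Balaban1983to89.Node00.BackgroundActionT
import Literature.MathematicalPhysics.QuantumFieldTheory.Balaban1983to89.Node00.BackgroundCurrentShape

/-!
# Node00 / BackgroundActionReg — the stage-₈ objects OVER A GENERIC REGULARITY CLASS (and transport), and the merged terms ALONG THE FINE FIELD

[Balaban1987RG1] = [I] (CMP 109, 1987) (0.21)–(0.23) p. 256, (1.1)–(1.3) p. 260, (1.6) p. 261; [Balaban1985Variational] = [B11] (CMP 102, 1985)
(2)–(8) pp. 278–279, Thm 1 p. 279.

Append-only successor of `Node00.BackgroundActionOfRecord` (₈a) and `Node00.BackgroundActionT` (seat pub-ymgap-node00-def-B, generation 2).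
NOTHING in those files, in `Node00.Record8`, or in any landed consumer is edited: every ₈a ∕ `…T` name is RECOVERED here by `rfl` ∕ `Iff.rfl` at the
plaquette class `regPlaq F N = bgReg F N` (and the transport of record `TOfRecord F N`).  TWO things.

(A) **REGULARITY-CLASS-GENERIC LAYER** (interface finding F7 of seat dag-n07-a, `B11-PIN-SOCKET.md` §4).  ₈a minimises the Wilson action over the
PLAQUETTE-ONLY class `bgReg K k ε = {U | |U(∂p) − 1| < ε η_k²}` (its located divergence D-defB-1).  Print does not: [B11] Thm 1 (8) p. 279 places the
minimal orbit in `𝔘_k({Ω_j}, B₃ε₁) ∩ 𝔅_k(𝔅_k, V)`, the space (2) p. 278 carrying BOTH the plaquette clause and the covariant-divergence (current)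
clause, and [I] (1.1) p. 260 speaks of «exactly one REGULAR, critical orbit … see Theorem 1 [15]».  A minimiser over the (2)-class need not minimise
over the larger plaquette class, so [B11] Thm 1 feeds ₈a's `UkExists` only through a converse that is NOT a sentence of print.  This module re-issues
₈ §1–§4 over a regularity-class FAMILY `𝓡 : RegClass F N := (K k : ℕ) → ℝ → Set (GaugeField (F.P K) 0 (SU N))` (`UkExistsR`, `UniqueUkOrbitR`, `UkR`,
`wilsonBGOfRecordR`, `EkOfRecordRT`, `mergedTermRT`, `mergedTermFamilyRT`, `mergedTermFamilyMatRT`, `ReprAOfRecordRT`, `IndAOfRecordRT`, `HCompRT`,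
`HOrbitR`, `HRestrictR`) and NAMES the (2)-class family of record-to-be `regB11 F N K k e := {U | InUkClassB11 F N K k e U}` ([B11] (2) at `Ω_j = T`,
`Node00.BackgroundCurrentShape`, seat dag-n01-b): `UkExistsR F N (regB11 F N) K k e V` unfolds (`Iff.rfl`) to «a minimiser of `A` over
`𝔘_k(e) ∩ {Ū^k = V}` exists» — Thm 1 (8) read at the objects (reading «critical ↦ minimal» of the N07 carrier), with NO a-priori item interposed.
RADII: Thm 1 gives existence in `𝔘_k(B₃ε₁)` and uniqueness of the critical orbit in `𝔘_k(ε₀)`, `B₃ε₁ ≤ ε₀ ≤ a₀`; a record reading both clauses at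
ONE radius takes `ε := B₃ε₁ = ε₀`.  D-defB-1 is thereby RETIRED for any record binding `𝓡 := regB11`; `Record8` (binding `bgReg`) is untouched.

(B) **THE MERGED TERMS ALONG THE FINE FIELD** (located repair (R-T2) of seat dag-n09-a).  Print evaluates the step terms AT THE FINE MINIMISER:
(0.23) p. 256 `𝐄_k(U_k) = Σ_{j<k} [−β_{j+1}(g_j)A(U_k) + 𝐄^{(j+1)}(U_k)]` («in the old only a background field is changed»), (1.3)∕(1.6) pp. 260–261
`𝐄^{(j+1)}(g_j, U_k)`.  ₈a typed the merged term as a functional of the COARSE datum `W` (`mergedTerm … j W = A_{j+1}(W) − A_j(Ū^j(U_{j+1}W))`, the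
shape the β-layer reads) and evaluated it in (0.23) at `W := Ū^{j+1}(U_k V)`, which makes the telescoping of (0.23) at the record depend on the
composition-of-minimisers input `HCompT` (⇐ [B11] restriction + (1.1)-uniqueness + gauge invariance of `A_j ∘ Ū^j`, hence on POINTWISE gauge
covariance of the transport — unavailable for version-valued transports, dag-n09-a [KERNEL-TRANSPORT-NOTE]).  Here the merged term is ALSO typed
along the fine field: `mergedTermFineT T χ K g j U := A_{j+1}(Ū^{j+1}U) − A_j(Ū^jU)` — class-free and `ε`-free; it telescopes for EVERY fine `U`
(`sum_mergedTermFineT`), so at `U := U_k(V)` the identity (0.23)∕(1.3) AT THE RECORD follows from χ-locality, the flow recursion `RGEqH` and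
(1.1)-EXISTENCE alone (`reprAFineRT_atRecord`, `indAFineRT_atRecord`: NO `HCompT`, `HInvT`, uniqueness or transport covariance) — the kernel form
of this observation at ₈a's objects is dag-n09-a's landed `B12EffectiveActionInvarianceT.sum_fixedTerm_eq` ∕ `repr023_fixedTerm` (cited by name,
neither imported nor restated; this module supplies the NAMED functional and the format PREDICATES a record can bind).  Nothing is lost:
`mergedTermFineT … j (U_{j+1}W) = mergedTermRT … j W` under (1.1)-existence at level `j+1` (`mergedTermFineT_UkR_succ` — the β-layer's functional),
the two evaluations at `U_k V` differ EXACTLY by the composition defect (`mergedTermFineT_UkR_eq_mergedTermRT_iff`), and the two format predicates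
agree exactly under `HCompRT` (`reprAFineRT_iff_reprAOfRecordRT`).  The composition input thus leaves the FORMAT clause (0.23) and stays where print
uses it — the identification (1.6) of the terms with the expansions whose bounds (0.24)–(0.30) are displayed (₈a GAPS row G₈a-7), not typed here.

RECORD-LEVEL USE (for the typer of `Record9`): `wilsonBG := wilsonBGOfRecordR F N 𝓡 ε`, `Ek := EkOfRecordRT F N 𝓡 T' χ ε β`,
`ReprA := ReprAFineRT F N 𝓡 T' χ ε β` (or `ReprAOfRecordRT`), `IndA := IndAFineRT …` (or `IndAOfRecordRT`), β via `mergedTermFamilyMatRT F N 𝓡 T' χ ε`,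
with `𝓡 := regB11 F N` and `T'` the stage's transport family (`T' : Transport F N`).
HONEST FRAMING: definitions of record re-issued over a parameter + kernel-checked telescoping ∕ bookkeeping identities; the print content ([B11]
Thm 1: `UkExistsR`, `UniqueUkOrbitR`, `HRestrictR`; every estimate) stays NAMED ∕ DISPLAYED, asserted nowhere; no instance, no notation; counts unmoved;
one finite `T⁴` per run; NOT continuum ∕ ℝ⁴ ∕ OS ∕ mass-gap ∕ Clay.
-/

noncomputable section

namespace Literature.MathematicalPhysics.QuantumFieldTheory.Balaban1983to89.Node00

open T4Continuum (T4Family)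
open FlowStep (HBeta prefixOf RGEqH)
open FlowStepRuns (genSeq)
open T4FlagMemory (extd)
open T4FlagMemoryTwoRun (extd_prefixOf)
open B12Eq019ActionBody (wilsonTerm)
open B12GaugeOrbits021 (OrbitRel IsResidual)

variable (F : T4Family) (N : ℕ) [NeZero N]

/-! ## §1. Regularity-class families and `U_k(V)` over a generic class ([I] (0.21) p. 256, (1.1)–(1.2) p. 260; [B11] (2)–(8) pp. 278–279) -/

/-- A REGULARITY-CLASS FAMILY: per torus `K`, level `k` and radius `ε`, the class of fine configurations within which the level-`k` variational
problem (0.21) is posed. [cite: Balaban1987RG1, (0.21) p.256] -/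
def RegClass : Type _ := (K k : ℕ) → ℝ → Set (GaugeField (F.P K) 0 (SU N))

/-- ₈a's PLAQUETTE-ONLY family `bgReg` (the first clause of [I] (1.2); divergence D-defB-1 of ₈a). [cite: Balaban1987RG1, (1.2) p.260] -/
def regPlaq : RegClass F N := fun K k ε => bgReg F N K k ε

/-- **THE (2)-CLASS FAMILY** — [B11] (2) p. 278 in the no-holes case `Ω_j = T` (plaquette AND covariant-divergence clauses, all levels `j ≤ k`,
`η = L^{−k}`): the class of Thm 1 (8), by name `Node00.InUkClassB11`. [cite: Balaban1985Variational, (2) p.278] -/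
def regB11 : RegClass F N := fun K k e => {U | InUkClassB11 F N K k e U}

/-- Unfolding. [cite: Balaban1987RG1, (1.2) p.260 (bookkeeping)] -/
theorem regPlaq_apply (K k : ℕ) (ε : ℝ) : regPlaq F N K k ε = bgReg F N K k ε := rfl

omit [NeZero N] in
/-- Unfolding. [cite: Balaban1985Variational, (2) p.278 (bookkeeping)] -/
theorem mem_regB11_iff (K k : ℕ) (e : ℝ) (U : GaugeField (F.P K) 0 (SU N)) : U ∈ regB11 F N K k e ↔ InUkClassB11 F N K k e U := Iff.rfl

/-- The (2)-class lies in the plaquette class at the same radius (`InUkClassB11.mem_bgReg`, dag-n01-b). [cite: Balaban1985Variational, (2) p.278] -/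
theorem regB11_subset_regPlaq (K k : ℕ) (e : ℝ) : regB11 F N K k e ⊆ regPlaq F N K k e := fun _ h => InUkClassB11.mem_bgReg h

/-- «The space 𝔘_k({Ω_j}, ε₀) is gauge invariant» ([B11] p. 278): the (2)-class family is stable under every gauge transformation
(`inUkClassB11_gaugeAct_iff`). [cite: Balaban1985Variational, p.278] -/
theorem gaugeAct_mem_regB11_iff {K k : ℕ} {e : ℝ} (u : GaugeTransf (F.P K) 0 (SU N)) (U : GaugeField (F.P K) 0 (SU N)) :
    GaugeField.gaugeAct u U ∈ regB11 F N K k e ↔ U ∈ regB11 F N K k e :=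
  inUkClassB11_gaugeAct_iff u U

/-- **EXISTENCE clause of [I] (1.1) over the class `𝓡`** (a NAMED Prop): the problem `A(U) → min` on `{Ū^k = V} ∩ 𝓡_k(ε)` is solvable.  At
`𝓡 := regB11 F N` this is [B11] Thm 1 (8) read «critical ↦ minimal»; asserted nowhere. [cite: Balaban1985Variational, Thm 1 (8) p.279] -/
def UkExistsR (𝓡 : RegClass F N) (K k : ℕ) (ε : ℝ) (V : GaugeField (F.P K) k (SU N)) : Prop :=
  ∃ U₀ : GaugeField (F.P K) 0 (SU N), IsBackground (avOfRecord F N K) (𝓡 K k ε) k V U₀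

/-- **UNIQUENESS clause of [I] (1.1) over the class `𝓡`** (a NAMED Prop): any two solutions lie in one residual orbit of level `k`.
[cite: Balaban1985Variational, Thm 1 p.279] -/
def UniqueUkOrbitR (𝓡 : RegClass F N) (K k : ℕ) (ε : ℝ) (V : GaugeField (F.P K) k (SU N)) : Prop :=
  ∀ U₀ U₀' : GaugeField (F.P K) 0 (SU N), IsBackground (avOfRecord F N K) (𝓡 K k ε) k V U₀ →
    IsBackground (avOfRecord F N K) (𝓡 K k ε) k V U₀' → OrbitRel k U₀ U₀'

/-- **`U_k(V)` over the class `𝓡`** — «a configuration in the minimal orbit» ([I] p. 260): `Classical.choose` on the solvable set, the unit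
configuration otherwise (documented junk default, ruling R434 (c2)). [cite: Balaban1987RG1, (0.21) p.256] -/
def UkR (𝓡 : RegClass F N) (K k : ℕ) (ε : ℝ) (V : GaugeField (F.P K) k (SU N)) : GaugeField (F.P K) 0 (SU N) := by
  classical
  exact if h : UkExistsR F N 𝓡 K k ε V then Classical.choose h else 1

variable {F N}

/-- ₈a's `UkExists` IS the generic clause at the plaquette family. [cite: Balaban1987RG1, (1.1) p.260 (bookkeeping)] -/
theorem ukExistsR_regPlaq_iff {K k : ℕ} {ε : ℝ} {V : GaugeField (F.P K) k (SU N)} :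
    UkExistsR F N (regPlaq F N) K k ε V ↔ UkExists F N K k ε V := Iff.rfl

/-- ₈a's `UniqueUkOrbit` IS the generic clause at the plaquette family. [cite: Balaban1987RG1, (1.1) p.260 (bookkeeping)] -/
theorem uniqueUkOrbitR_regPlaq_iff {K k : ℕ} {ε : ℝ} {V : GaugeField (F.P K) k (SU N)} :
    UniqueUkOrbitR F N (regPlaq F N) K k ε V ↔ UniqueUkOrbit F N K k ε V := Iff.rfl

/-- ₈a's `Uk` IS the generic minimiser at the plaquette family (`rfl`). [cite: Balaban1987RG1, (0.21) p.256 (bookkeeping)] -/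
theorem ukR_regPlaq (K k : ℕ) (ε : ℝ) (V : GaugeField (F.P K) k (SU N)) : UkR F N (regPlaq F N) K k ε V = Uk F N K k ε V := rfl

/-- **THE N07 SOCKET**: at the (2)-class family the existence clause unfolds to «a minimiser of `A` over `𝔘_k(e) ∩ {Ū^k = V}` exists» — [B11]
Thm 1 (8) at the objects of record (`Iff.rfl`). [cite: Balaban1985Variational, Thm 1 (8) p.279] -/
theorem ukExistsR_regB11_iff {K k : ℕ} {e : ℝ} {V : GaugeField (F.P K) k (SU N)} :
    UkExistsR F N (regB11 F N) K k e V ↔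
      ∃ U₀ : GaugeField (F.P K) 0 (SU N), IsBackground (avOfRecord F N K) {U | InUkClassB11 F N K k e U} k V U₀ := Iff.rfl

/-- Unfolding on the solvable set. [cite: Balaban1987RG1, (0.21) p.256 (bookkeeping)] -/
theorem ukR_eq_choose {𝓡 : RegClass F N} {K k : ℕ} {ε : ℝ} {V : GaugeField (F.P K) k (SU N)} (h : UkExistsR F N 𝓡 K k ε V) :
    UkR F N 𝓡 K k ε V = Classical.choose h := by
  unfold UkR
  rw [dif_pos h]

/-- Off the solvable set `U_k(V)` is the unit configuration. [cite: Balaban1987RG1, (0.21) p.256 (bookkeeping)] -/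
theorem ukR_of_not {𝓡 : RegClass F N} {K k : ℕ} {ε : ℝ} {V : GaugeField (F.P K) k (SU N)} (h : ¬ UkExistsR F N 𝓡 K k ε V) :
    UkR F N 𝓡 K k ε V = 1 := by
  unfold UkR
  rw [dif_neg h]

/-- **THE CHARACTERISING PROPERTY**: on the solvable set `U_k(V)` minimises `A` on `{Ū^k = V}` within `𝓡_k(ε)`. [cite: Balaban1985Variational, Thm 1 p.279] -/
theorem isBackground_ukR {𝓡 : RegClass F N} {K k : ℕ} {ε : ℝ} {V : GaugeField (F.P K) k (SU N)} (h : UkExistsR F N 𝓡 K k ε V) :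
    IsBackground (avOfRecord F N K) (𝓡 K k ε) k V (UkR F N 𝓡 K k ε V) := by
  rw [ukR_eq_choose h]
  exact Classical.choose_spec h

/-- `Ū^k(U_k(V)) = V` on the solvable set. [cite: Balaban1987RG1, (0.21) p.256] -/
theorem iter_ukR {𝓡 : RegClass F N} {K k : ℕ} {ε : ℝ} {V : GaugeField (F.P K) k (SU N)} (h : UkExistsR F N 𝓡 K k ε V) :
    Averaging.iter (avOfRecord F N K) k (UkR F N 𝓡 K k ε V) = V :=
  (isBackground_ukR h).1

/-- `U_k(V) ∈ 𝓡_k(ε)` on the solvable set. [cite: Balaban1987RG1, (1.2) p.260] -/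
theorem ukR_mem {𝓡 : RegClass F N} {K k : ℕ} {ε : ℝ} {V : GaugeField (F.P K) k (SU N)} (h : UkExistsR F N 𝓡 K k ε V) :
    UkR F N 𝓡 K k ε V ∈ 𝓡 K k ε :=
  (isBackground_ukR h).2.1

/-- Minimality of `A(U_k(V))` within the class, on the solvable set. [cite: Balaban1987RG1, (0.21) p.256] -/
theorem wilsonAction4_ukR_le {𝓡 : RegClass F N} {K k : ℕ} {ε : ℝ} {V : GaugeField (F.P K) k (SU N)} (h : UkExistsR F N 𝓡 K k ε V)
    {U : GaugeField (F.P K) 0 (SU N)} (hU : U ∈ 𝓡 K k ε) (hUV : Averaging.iter (avOfRecord F N K) k U = V) :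
    wilsonAction4 (UkR F N 𝓡 K k ε V) ≤ wilsonAction4 U :=
  (isBackground_ukR h).2.2 U hU hUV

/-- **The VALUE `A(U_k(V))` is canonical**: every minimiser over the class has the Wilson action of the chosen one.
[cite: Balaban1987RG1, (0.21)–(0.22) p.256] -/
theorem wilsonAction4_eq_of_isBackgroundR {𝓡 : RegClass F N} {K k : ℕ} {ε : ℝ} {V : GaugeField (F.P K) k (SU N)}
    {U₀ : GaugeField (F.P K) 0 (SU N)} (h : IsBackground (avOfRecord F N K) (𝓡 K k ε) k V U₀) :
    wilsonAction4 U₀ = wilsonAction4 (UkR F N 𝓡 K k ε V) :=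
  le_antisymm (h.2.2 _ (ukR_mem ⟨U₀, h⟩) (iter_ukR ⟨U₀, h⟩)) (wilsonAction4_ukR_le ⟨U₀, h⟩ h.2.1 h.1)

/-- **F7, THE FORMAL DIRECTION AT OBJECTS**: a minimiser over a class, lying in a SUBCLASS, minimises over the subclass.
[cite: Balaban1985Variational, Thm 1 (8) p.279 (bookkeeping)] -/
theorem isBackground_of_subset_of_mem {K k : ℕ} {S S' : Set (GaugeField (F.P K) 0 (SU N))} (hsub : S' ⊆ S)
    {V : GaugeField (F.P K) k (SU N)} {U₀ : GaugeField (F.P K) 0 (SU N)} (h : IsBackground (avOfRecord F N K) S k V U₀) (hmem : U₀ ∈ S') :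
    IsBackground (avOfRecord F N K) S' k V U₀ :=
  ⟨h.1, hmem, fun U hU hUV => h.2.2 U (hsub hU) hUV⟩

/-- In particular ₈a's minimiser, IF it lies in the (2)-class, solves the (2)-class problem (the converse is not formal and not in print).
[cite: Balaban1985Variational, Thm 1 (8) p.279 (bookkeeping)] -/
theorem ukExistsR_regB11_of_ukExists_of_mem {K k : ℕ} {e : ℝ} {V : GaugeField (F.P K) k (SU N)} (h : UkExists F N K k e V)
    (hmem : InUkClassB11 F N K k e (Uk F N K k e V)) : UkExistsR F N (regB11 F N) K k e V :=
  ⟨Uk F N K k e V, isBackground_of_subset_of_mem (regB11_subset_regPlaq F N K k e) (isBackground_Uk h) hmem⟩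

/-- The (2)-class minimiser lies in ₈a's plaquette class (first clause of [I] (1.2)) on the solvable set. [cite: Balaban1987RG1, (1.2) p.260] -/
theorem ukR_regB11_mem_bgReg {K k : ℕ} {e : ℝ} {V : GaugeField (F.P K) k (SU N)} (h : UkExistsR F N (regB11 F N) K k e V) :
    UkR F N (regB11 F N) K k e V ∈ bgReg F N K k e :=
  InUkClassB11.mem_bgReg (ukR_mem h)

/-- The (2)-class minimiser satisfies [B11] (2) (both clauses) on the solvable set — print's «U_k(V) ∈ 𝔘_k(ε₀)» of [I] p. 260 in the (2)-currency,
here DEFINITIONAL (compare ₈a's displayed row G₈a-3 `UkInSpaceB11`). [cite: Balaban1985Variational, Thm 1 (8) p.279] -/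
theorem inUkClassB11_ukR {K k : ℕ} {e : ℝ} {V : GaugeField (F.P K) k (SU N)} (h : UkExistsR F N (regB11 F N) K k e V) :
    InUkClassB11 F N K k e (UkR F N (regB11 F N) K k e V) :=
  ukR_mem h

/-- Base of the induction `k = 0` (no averaging): solvable iff `V` itself lies in the class, and then `U_0(V) = V`.
[cite: Balaban1987RG1, (0.17) p.255 (bookkeeping)] -/
theorem ukExistsR_zero_iff {𝓡 : RegClass F N} {K : ℕ} {ε : ℝ} {V : GaugeField (F.P K) 0 (SU N)} :
    UkExistsR F N 𝓡 K 0 ε V ↔ V ∈ 𝓡 K 0 ε := by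
  constructor
  · rintro ⟨U₀, h0, hreg, -⟩
    have : U₀ = V := h0
    exact this ▸ hreg
  · intro hV
    exact ⟨V, rfl, hV, fun U _ hU => by rw [show U = V from hU]⟩

/-- `U_0(V) = V` on the solvable set. [cite: Balaban1987RG1, (0.17) p.255 (bookkeeping)] -/
theorem ukR_zero {𝓡 : RegClass F N} {K : ℕ} {ε : ℝ} {V : GaugeField (F.P K) 0 (SU N)} (h : UkExistsR F N 𝓡 K 0 ε V) :
    UkR F N 𝓡 K 0 ε V = V :=
  iter_ukR h

variable (F N)

/-- **`A^η(U_k(V))` over the class `𝓡`**, per run `p` and step `k` (the type of `Residual₅.wilsonBG` once `𝓡, ε` are fixed).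
[cite: Balaban1987RG1, (0.22) p.256] -/
def wilsonBGOfRecordR (𝓡 : RegClass F N) (ε : ℝ) (p : B12.RunParams) (k : ℕ) (V : GaugeField (F.P p.K) k (SU N)) : ℝ :=
  wilsonAction4 (UkR F N 𝓡 p.K k ε V)

/-- Bridge (`rfl`). [cite: Balaban1987RG1, (0.22) p.256 (bookkeeping)] -/
theorem wilsonBGOfRecord_eq_R (ε : ℝ) : wilsonBGOfRecord F N ε = wilsonBGOfRecordR F N (regPlaq F N) ε := rfl

/-- `A^η(U_k(V)) ≥ 0`. [cite: Balaban1987RG1, (0.2) p.252] -/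
theorem wilsonBGOfRecordR_nonneg (𝓡 : RegClass F N) (ε : ℝ) (p : B12.RunParams) (k : ℕ) (V : GaugeField (F.P p.K) k (SU N)) :
    0 ≤ wilsonBGOfRecordR F N 𝓡 ε p k V :=
  wilsonAction4_nonneg _

variable {F N}

/-- `A^η(U_0(V)) = A(V)` for `V` in the class. [cite: Balaban1987RG1, (0.17) p.255 (bookkeeping)] -/
theorem wilsonBGOfRecordR_zero {𝓡 : RegClass F N} {ε : ℝ} {p : B12.RunParams} {V : GaugeField (F.P p.K) 0 (SU N)} (hV : V ∈ 𝓡 p.K 0 ε) :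
    wilsonBGOfRecordR F N 𝓡 ε p 0 V = wilsonAction4 V := by
  unfold wilsonBGOfRecordR
  rw [ukR_zero (ukExistsR_zero_iff.2 hV)]

variable (F N)

/-! ## §2. `𝐄_k` and the merged terms over `(𝓡, T)`; the merged terms ALONG THE FINE FIELD ([I] (0.22)–(0.23) p. 256, (1.3)∕(1.6) pp. 260–261) -/

/-- `𝐄_k := A_k + (1/g_k²)A^η(U_k)` ((0.22) as definition) over `(𝓡, T)` (junk note of `EkOfRecordT` applies at `g_k = 0`).
[cite: Balaban1987RG1, (0.22) p.256] -/
def EkOfRecordRT (𝓡 : RegClass F N) (T : Transport F N) (χ : (K : ℕ) → (ℕ → ℝ) → (k : ℕ) → Density (F.P K) k (SU N)) (ε : ℝ)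
    (β : HBeta) (p : B12.RunParams) (k : ℕ) (V : GaugeField (F.P p.K) k (SU N)) : ℝ :=
  effActionOfRecordT F N T χ β p k V + (1 / (genSeq β p.g0 k) ^ 2) * wilsonBGOfRecordR F N 𝓡 ε p k V

/-- Bridge (`rfl`). [cite: Balaban1987RG1, (0.22) p.256 (bookkeeping)] -/
theorem EkOfRecordT_eq_R (T : Transport F N) (χ : (K : ℕ) → (ℕ → ℝ) → (k : ℕ) → Density (F.P K) k (SU N)) (ε : ℝ) (β : HBeta)
    (p : B12.RunParams) (k : ℕ) : EkOfRecordT F N T χ ε β p k = EkOfRecordRT F N (regPlaq F N) T χ ε β p k := rfl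

/-- The merged per-step term AS A FUNCTIONAL OF THE COARSE DATUM, `𝓝_{k+1}(g; W) := A_{k+1}(W) − A_k(Ū^k(U_{k+1}(W)))` ((1.6)), over `(𝓡, T)` —
the shape the β-layer reads. [cite: Balaban1987RG1, (1.6) p.261] -/
def mergedTermRT (𝓡 : RegClass F N) (T : Transport F N) (χ : (K : ℕ) → (ℕ → ℝ) → (k : ℕ) → Density (F.P K) k (SU N)) (ε : ℝ) (K : ℕ)
    (g : ℕ → ℝ) (k : ℕ) (W : GaugeField (F.P K) (k + 1) (SU N)) : ℝ :=
  effActionHT F N T χ K g (k + 1) W - effActionHT F N T χ K g k (Averaging.iter (avOfRecord F N K) k (UkR F N 𝓡 K (k + 1) ε W))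

/-- Bridge (`rfl`). [cite: Balaban1987RG1, (1.6) p.261 (bookkeeping)] -/
theorem mergedTermT_eq_R (T : Transport F N) (χ : (K : ℕ) → (ℕ → ℝ) → (k : ℕ) → Density (F.P K) k (SU N)) (ε : ℝ) (K : ℕ) (g : ℕ → ℝ)
    (k : ℕ) : mergedTermT F N T χ ε K g k = mergedTermRT F N (regPlaq F N) T χ ε K g k := rfl

/-- The merged term family (β-layer shape) over `(𝓡, T)`, read through `r : 𝔄 → SU(N)`. [cite: Balaban1987RG1, (1.20)–(1.22) p.264] -/
def mergedTermFamilyRT (𝓡 : RegClass F N) (T : Transport F N) (χ : (K : ℕ) → (ℕ → ℝ) → (k : ℕ) → Density (F.P K) k (SU N)) (ε : ℝ)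
    {𝔄 : Type*} (r : 𝔄 → SU N) : (k : ℕ) → (Fin (k + 1) → ℝ) → (K : ℕ) → ((Fin (F.P K).d → Site (F.P K) (k + 1) → 𝔄) → ℝ) :=
  fun k hist K W => mergedTermRT F N 𝓡 T χ ε K (extd hist) k (readField F N r W)

/-- Bridge (`rfl`). [cite: Balaban1987RG1, (1.20) p.264 (bookkeeping)] -/
theorem mergedTermFamilyT_eq_R (T : Transport F N) (χ : (K : ℕ) → (ℕ → ℝ) → (k : ℕ) → Density (F.P K) k (SU N)) (ε : ℝ) {𝔄 : Type*}
    (r : 𝔄 → SU N) : mergedTermFamilyT F N T χ ε r = mergedTermFamilyRT F N (regPlaq F N) T χ ε r := rfl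

/-- The matrix-carrier export over `(𝓡, T)` — the socket of `Node00.BetaOfRecord.betaMerged`. [cite: Balaban1987RG1, (1.20)–(1.22) p.264] -/
def mergedTermFamilyMatRT (𝓡 : RegClass F N) (T : Transport F N) (χ : (K : ℕ) → (ℕ → ℝ) → (k : ℕ) → Density (F.P K) k (SU N)) (ε : ℝ) :
    (k : ℕ) → (Fin (k + 1) → ℝ) → (K : ℕ) → ((Fin (F.P K).d → Site (F.P K) (k + 1) → Matrix (Fin N) (Fin N) ℂ) → ℝ) :=
  mergedTermFamilyRT F N 𝓡 T χ ε (suOfMat N)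

/-- Bridge (`rfl`; hence `mergedTermFamilyMat F N χ ε = mergedTermFamilyMatRT F N (regPlaq F N) (TOfRecord F N) χ ε` too).
[cite: Balaban1987RG1, (1.20) p.264 (bookkeeping)] -/
theorem mergedTermFamilyMatT_eq_R (T : Transport F N) (χ : (K : ℕ) → (ℕ → ℝ) → (k : ℕ) → Density (F.P K) k (SU N)) (ε : ℝ) :
    mergedTermFamilyMatT F N T χ ε = mergedTermFamilyMatRT F N (regPlaq F N) T χ ε := rfl

/-- ₈a's matrix export IS the generic one at `(regPlaq, TOfRecord)` (`rfl`). [cite: Balaban1987RG1, (1.20) p.264 (bookkeeping)] -/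
theorem mergedTermFamilyMat_eq_R (χ : (K : ℕ) → (ℕ → ℝ) → (k : ℕ) → Density (F.P K) k (SU N)) (ε : ℝ) :
    mergedTermFamilyMat F N χ ε = mergedTermFamilyMatRT F N (regPlaq F N) (TOfRecord F N) χ ε := rfl

/-- **THE MERGED TERM ALONG THE FINE FIELD** — print's currency in (0.23) p. 256 and (1.3)∕(1.6) pp. 260–261 (`𝐄^{(j+1)}(g_j, U_k)`: the step
terms evaluated at the fine minimiser): `𝓝^{fine}_{j+1}(g; U) := A_{j+1}(g; Ū^{j+1}U) − A_j(g; Ū^jU)` for ANY fine configuration `U`.  Class-free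
and radius-free. [cite: Balaban1987RG1, (0.23) p.256] -/
def mergedTermFineT (T : Transport F N) (χ : (K : ℕ) → (ℕ → ℝ) → (k : ℕ) → Density (F.P K) k (SU N)) (K : ℕ) (g : ℕ → ℝ) (j : ℕ)
    (U : GaugeField (F.P K) 0 (SU N)) : ℝ :=
  effActionHT F N T χ K g (j + 1) (Averaging.iter (avOfRecord F N K) (j + 1) U) -
    effActionHT F N T χ K g j (Averaging.iter (avOfRecord F N K) j U)

variable {F N}

/-- **TELESCOPING ALONG THE FINE FIELD, NO HYPOTHESIS**: `Σ_{j<k} 𝓝^{fine}_{j+1}(g; U) = A_k(g; Ū^kU) + (1/g_0²)·A^η(U)` for every fine `U`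
(`A_0 = −(1/g_0²)A^η`, `Ū^0 = id`).  PRECEDENT BY NAME (not imported, not restated): the instance `U := Uk F N K k ε V` over ₈a's plaquette class is
seat dag-n09-a's landed `B12EffectiveActionInvarianceT.sum_fixedTerm_eq`; this module adds the named functional, the arbitrary fine `U` and the
generic class. [cite: Balaban1987RG1, (0.23) p.256] -/
theorem sum_mergedTermFineT (T : Transport F N) (χ : (K : ℕ) → (ℕ → ℝ) → (k : ℕ) → Density (F.P K) k (SU N)) (K : ℕ) (g : ℕ → ℝ)
    (k : ℕ) (U : GaugeField (F.P K) 0 (SU N)) :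
    ∑ j ∈ Finset.range k, mergedTermFineT F N T χ K g j U =
      effActionHT F N T χ K g k (Averaging.iter (avOfRecord F N K) k U) + (1 / (g 0) ^ 2) * wilsonAction4 U := by
  unfold mergedTermFineT
  rw [Finset.sum_range_sub (fun j => effActionHT F N T χ K g j (Averaging.iter (avOfRecord F N K) j U)) k]
  show effActionHT F N T χ K g k _ - wilsonTerm (g 0) 1 U = _
  rw [B12Eq019ActionBody.wilsonTerm]
  unfold wilsonAction4
  ring

/-- The same at a configuration averaging to `V`. [cite: Balaban1987RG1, (0.23) p.256] -/
theorem sum_mergedTermFineT_of_iter (T : Transport F N) (χ : (K : ℕ) → (ℕ → ℝ) → (k : ℕ) → Density (F.P K) k (SU N)) {K : ℕ}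
    (g : ℕ → ℝ) {k : ℕ} {U : GaugeField (F.P K) 0 (SU N)} {V : GaugeField (F.P K) k (SU N)}
    (hU : Averaging.iter (avOfRecord F N K) k U = V) :
    ∑ j ∈ Finset.range k, mergedTermFineT F N T χ K g j U = effActionHT F N T χ K g k V + (1 / (g 0) ^ 2) * wilsonAction4 U := by
  rw [sum_mergedTermFineT, hU]

/-- **AT THE MINIMISER OF RECORD over any class**, from (1.1)-EXISTENCE alone: `Σ_{j<k} 𝓝^{fine}_{j+1}(g; U_k V) = A_k(g; V) + (1/g_0²)·A^η(U_k V)`.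
[cite: Balaban1987RG1, (0.23) p.256] -/
theorem sum_mergedTermFineT_ukR (𝓡 : RegClass F N) (T : Transport F N) (χ : (K : ℕ) → (ℕ → ℝ) → (k : ℕ) → Density (F.P K) k (SU N))
    {K : ℕ} (g : ℕ → ℝ) {k : ℕ} {ε : ℝ} {V : GaugeField (F.P K) k (SU N)} (h : UkExistsR F N 𝓡 K k ε V) :
    ∑ j ∈ Finset.range k, mergedTermFineT F N T χ K g j (UkR F N 𝓡 K k ε V) =
      effActionHT F N T χ K g k V + (1 / (g 0) ^ 2) * wilsonAction4 (UkR F N 𝓡 K k ε V) :=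
  sum_mergedTermFineT_of_iter T χ g (iter_ukR h)

/-- **LINK TO THE COARSE-DATUM FUNCTIONAL** (the one the β-layer reads): at the level-`(j+1)` minimiser of a datum `W`,
`𝓝^{fine}_{j+1}(g; U_{j+1}W) = 𝓝_{j+1}(g; W)` — by `Ū^{j+1}(U_{j+1}W) = W`, i.e. from (1.1)-existence at level `j+1` alone.
[cite: Balaban1987RG1, (1.6) p.261] -/
theorem mergedTermFineT_ukR_succ (𝓡 : RegClass F N) (T : Transport F N) (χ : (K : ℕ) → (ℕ → ℝ) → (k : ℕ) → Density (F.P K) k (SU N))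
    {K : ℕ} (g : ℕ → ℝ) {j : ℕ} {ε : ℝ} {W : GaugeField (F.P K) (j + 1) (SU N)} (h : UkExistsR F N 𝓡 K (j + 1) ε W) :
    mergedTermFineT F N T χ K g j (UkR F N 𝓡 K (j + 1) ε W) = mergedTermRT F N 𝓡 T χ ε K g j W := by
  unfold mergedTermFineT mergedTermRT
  rw [iter_ukR h]

/-- The ₈a ∕ `…T` instance of the link: `𝓝^{fine}_{j+1}(g; U_{j+1}W) = mergedTermT … j W` under ₈a's `UkExists` at level `j+1`.
[cite: Balaban1987RG1, (1.6) p.261 (bookkeeping)] -/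
theorem mergedTermFineT_uk_succ (T : Transport F N) (χ : (K : ℕ) → (ℕ → ℝ) → (k : ℕ) → Density (F.P K) k (SU N)) {K : ℕ} (g : ℕ → ℝ)
    {j : ℕ} {ε : ℝ} {W : GaugeField (F.P K) (j + 1) (SU N)} (h : UkExists F N K (j + 1) ε W) :
    mergedTermFineT F N T χ K g j (Uk F N K (j + 1) ε W) = mergedTermT F N T χ ε K g j W :=
  mergedTermFineT_ukR_succ (regPlaq F N) T χ g h

/-- **WHERE THE COMPOSITION INPUT WENT**: at `U_k V` the fine term and the coarse-datum term at `Ū^{j+1}(U_k V)` differ EXACTLY by the composition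
defect of the actions, `A_j(Ū^j(U_{j+1}(Ū^{j+1}U_kV))) = A_j(Ū^j U_kV)` (the `j`-th clause of `HCompRT`). [cite: Balaban1987RG1, (1.1) p.260 (bookkeeping)] -/
theorem mergedTermFineT_ukR_eq_mergedTermRT_iff (𝓡 : RegClass F N) (T : Transport F N)
    (χ : (K : ℕ) → (ℕ → ℝ) → (k : ℕ) → Density (F.P K) k (SU N)) {K : ℕ} (g : ℕ → ℝ) (k j : ℕ) (ε : ℝ) (V : GaugeField (F.P K) k (SU N)) :
    mergedTermFineT F N T χ K g j (UkR F N 𝓡 K k ε V) =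
        mergedTermRT F N 𝓡 T χ ε K g j (Averaging.iter (avOfRecord F N K) (j + 1) (UkR F N 𝓡 K k ε V)) ↔
      effActionHT F N T χ K g j (Averaging.iter (avOfRecord F N K) j
          (UkR F N 𝓡 K (j + 1) ε (Averaging.iter (avOfRecord F N K) (j + 1) (UkR F N 𝓡 K k ε V)))) =
        effActionHT F N T χ K g j (Averaging.iter (avOfRecord F N K) j (UkR F N 𝓡 K k ε V)) := by
  unfold mergedTermFineT mergedTermRT
  rw [sub_right_inj, eq_comm]

variable (F N)

/-! ## §3. The located hypotheses over `(𝓡, T)`, NAMED; the format predicates in BOTH currencies; (0.23)∕(1.3) at the record -/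

/-- **COMPOSITION OF MINIMISERS SEEN BY THE ACTIONS** over `(𝓡, T)` (₈'s `HCompT` at the plaquette family).
[cite: Balaban1987RG1, (1.1) p.260; Balaban1985Variational, Thm 1 p.279] -/
def HCompRT (𝓡 : RegClass F N) (T : Transport F N) (χ : (K : ℕ) → (ℕ → ℝ) → (k : ℕ) → Density (F.P K) k (SU N)) (ε : ℝ) (K : ℕ)
    (g : ℕ → ℝ) (k : ℕ) (dom : Set (GaugeField (F.P K) k (SU N))) : Prop :=
  ∀ V ∈ dom, ∀ j < k,
    effActionHT F N T χ K g j (Averaging.iter (avOfRecord F N K) j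
        (UkR F N 𝓡 K (j + 1) ε (Averaging.iter (avOfRecord F N K) (j + 1) (UkR F N 𝓡 K k ε V)))) =
      effActionHT F N T χ K g j (Averaging.iter (avOfRecord F N K) j (UkR F N 𝓡 K k ε V))

/-- Bridge (`Iff.rfl`). [cite: Balaban1987RG1, (1.1) p.260 (bookkeeping)] -/
theorem hCompT_iff_R (T : Transport F N) (χ : (K : ℕ) → (ℕ → ℝ) → (k : ℕ) → Density (F.P K) k (SU N)) (ε : ℝ) (K : ℕ) (g : ℕ → ℝ)
    (k : ℕ) (dom : Set (GaugeField (F.P K) k (SU N))) : HCompT F N T χ ε K g k dom ↔ HCompRT F N (regPlaq F N) T χ ε K g k dom := Iff.rfl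

/-- **ONE RESIDUAL ORBIT** over `𝓡` ([I] (1.1) «exactly one … orbit» at the intermediate levels). [cite: Balaban1987RG1, (1.1) p.260] -/
def HOrbitR (𝓡 : RegClass F N) (ε : ℝ) (K k : ℕ) (dom : Set (GaugeField (F.P K) k (SU N))) : Prop :=
  ∀ V ∈ dom, ∀ j < k, OrbitRel (j + 1) (UkR F N 𝓡 K k ε V)
    (UkR F N 𝓡 K (j + 1) ε (Averaging.iter (avOfRecord F N K) (j + 1) (UkR F N 𝓡 K k ε V)))

/-- Bridge (`Iff.rfl`). [cite: Balaban1987RG1, (1.1) p.260 (bookkeeping)] -/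
theorem hOrbit_iff_R (ε : ℝ) (K k : ℕ) (dom : Set (GaugeField (F.P K) k (SU N))) :
    HOrbit F N ε K k dom ↔ HOrbitR F N (regPlaq F N) ε K k dom := Iff.rfl

/-- **THE GLOBAL MINIMISER RESTRICTS** over `𝓡` ([B11] Thm 1 (8)–(10) — [B11]-grade in EVERY class reading: the level-`(j+1)` class at radius `ε`
is not formally comparable with the level-`k` one; NAMED, asserted nowhere). [cite: Balaban1985Variational, Thm 1 (8)-(10) p.279] -/
def HRestrictR (𝓡 : RegClass F N) (ε : ℝ) (K k : ℕ) (dom : Set (GaugeField (F.P K) k (SU N))) : Prop :=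
  ∀ V ∈ dom, ∀ j < k, IsBackground (avOfRecord F N K) (𝓡 K (j + 1) ε) (j + 1)
    (Averaging.iter (avOfRecord F N K) (j + 1) (UkR F N 𝓡 K k ε V)) (UkR F N 𝓡 K k ε V)

/-- Bridge (`Iff.rfl`). [cite: Balaban1985Variational, Thm 1 p.279 (bookkeeping)] -/
theorem hRestrict_iff_R (ε : ℝ) (K k : ℕ) (dom : Set (GaugeField (F.P K) k (SU N))) :
    HRestrict F N ε K k dom ↔ HRestrictR F N (regPlaq F N) ε K k dom := Iff.rfl

variable {F N}

/-- `HRestrictR` + uniqueness (1.1) at the intermediate levels ⇒ `HOrbitR`. [cite: Balaban1987RG1, (1.1) p.260 (bookkeeping)] -/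
theorem hOrbitR_of_hRestrictR_of_unique {𝓡 : RegClass F N} {ε : ℝ} {K k : ℕ} {dom : Set (GaugeField (F.P K) k (SU N))}
    (hR : HRestrictR F N 𝓡 ε K k dom)
    (hU : ∀ V ∈ dom, ∀ j < k, UniqueUkOrbitR F N 𝓡 K (j + 1) ε (Averaging.iter (avOfRecord F N K) (j + 1) (UkR F N 𝓡 K k ε V))) :
    HOrbitR F N 𝓡 ε K k dom := by
  intro V hV j hj
  have hB := hR V hV j hj
  exact hU V hV j hj _ _ hB (isBackground_ukR ⟨_, hB⟩)

/-- `HOrbitR ∧ HInvT ⇒ HCompRT` (`HInvT` is class-free). [cite: Balaban1987RG1, (1.1) p.260 (bookkeeping)] -/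
theorem hCompRT_of_hOrbitR_of_hInvT {𝓡 : RegClass F N} (T : Transport F N) (χ : (K : ℕ) → (ℕ → ℝ) → (k : ℕ) → Density (F.P K) k (SU N))
    {ε : ℝ} {K : ℕ} {g : ℕ → ℝ} {k : ℕ} {dom : Set (GaugeField (F.P K) k (SU N))} (hO : HOrbitR F N 𝓡 ε K k dom)
    (hI : HInvT F N T χ K g k) : HCompRT F N 𝓡 T χ ε K g k dom := by
  intro V hV j hj
  obtain ⟨u, hu, hEq⟩ := hO V hV j hj
  rw [hEq]
  exact hI j hj u hu _

variable (F N)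

/-- The format predicate (0.22) ∧ (0.23) IN THE COARSE-DATUM CURRENCY over `(𝓡, T)` (₈a's `ReprAOfRecord` at the plaquette family and the transport
of record). [cite: Balaban1987RG1, (0.22)–(0.23) p.256] -/
def ReprAOfRecordRT (𝓡 : RegClass F N) (T : Transport F N) (χ : (K : ℕ) → (ℕ → ℝ) → (k : ℕ) → Density (F.P K) k (SU N)) (ε : ℝ) (β : HBeta)
    (p : B12.RunParams) (k : ℕ) (hist : Fin (k + 1) → ℝ) (dom : Set (GaugeField (F.P p.K) k (SU N)))
    (A W E : GaugeField (F.P p.K) k (SU N) → ℝ) : Prop :=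
  (∀ V ∈ dom, A V = -(1 / (hist (Fin.last k)) ^ 2) * W V + E V) ∧
  (∀ V ∈ dom, E V = ∑ j ∈ Finset.range k,
      (-(β j (prefixOf (extd hist) j)) * W V +
        mergedTermRT F N 𝓡 T χ ε p.K (extd hist) j (Averaging.iter (avOfRecord F N p.K) (j + 1) (UkR F N 𝓡 p.K k ε V))))

/-- Bridge (`rfl`). [cite: Balaban1987RG1, (0.22)–(0.23) p.256 (bookkeeping)] -/
theorem reprAOfRecordT_eq_R (T : Transport F N) (χ : (K : ℕ) → (ℕ → ℝ) → (k : ℕ) → Density (F.P K) k (SU N)) (ε : ℝ) (β : HBeta)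
    (p : B12.RunParams) (k : ℕ) : ReprAOfRecordT F N T χ ε β p k = ReprAOfRecordRT F N (regPlaq F N) T χ ε β p k := rfl

/-- The inductive-assumption predicate (1.1) ∧ (0.22)–(0.23), coarse-datum currency, over `(𝓡, T)`. [cite: Balaban1987RG1, (1.1)–(1.3) p.260] -/
def IndAOfRecordRT (𝓡 : RegClass F N) (T : Transport F N) (χ : (K : ℕ) → (ℕ → ℝ) → (k : ℕ) → Density (F.P K) k (SU N)) (ε : ℝ) (β : HBeta)
    (p : B12.RunParams) (k : ℕ) (hist : Fin (k + 1) → ℝ) (dom : Set (GaugeField (F.P p.K) k (SU N)))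
    (A W E : GaugeField (F.P p.K) k (SU N) → ℝ) : Prop :=
  (∀ V ∈ dom, UkExistsR F N 𝓡 p.K k ε V ∧ UniqueUkOrbitR F N 𝓡 p.K k ε V) ∧ ReprAOfRecordRT F N 𝓡 T χ ε β p k hist dom A W E

/-- Bridge (`rfl`). [cite: Balaban1987RG1, (1.3) p.260 (bookkeeping)] -/
theorem indAOfRecordT_eq_R (T : Transport F N) (χ : (K : ℕ) → (ℕ → ℝ) → (k : ℕ) → Density (F.P K) k (SU N)) (ε : ℝ) (β : HBeta)
    (p : B12.RunParams) (k : ℕ) : IndAOfRecordT F N T χ ε β p k = IndAOfRecordRT F N (regPlaq F N) T χ ε β p k := rfl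

/-- **THE FORMAT PREDICATE (0.22) ∧ (0.23) IN THE FINE CURRENCY** over `(𝓡, T)`: the step terms of (0.23) are the merged terms ALONG THE FINE FIELD
evaluated at `U_k(V)` — print's `𝐄^{(j+1)}(g_j, U_k)`.  Same argument list as ₈a's `ReprAOfRecord` (a drop-in for the record's `ReprA` slot).
[cite: Balaban1987RG1, (0.22)–(0.23) p.256] -/
def ReprAFineRT (𝓡 : RegClass F N) (T : Transport F N) (χ : (K : ℕ) → (ℕ → ℝ) → (k : ℕ) → Density (F.P K) k (SU N)) (ε : ℝ) (β : HBeta)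
    (p : B12.RunParams) (k : ℕ) (hist : Fin (k + 1) → ℝ) (dom : Set (GaugeField (F.P p.K) k (SU N)))
    (A W E : GaugeField (F.P p.K) k (SU N) → ℝ) : Prop :=
  (∀ V ∈ dom, A V = -(1 / (hist (Fin.last k)) ^ 2) * W V + E V) ∧
  (∀ V ∈ dom, E V = ∑ j ∈ Finset.range k,
      (-(β j (prefixOf (extd hist) j)) * W V + mergedTermFineT F N T χ p.K (extd hist) j (UkR F N 𝓡 p.K k ε V)))

/-- **THE INDUCTIVE-ASSUMPTION PREDICATE (1.1) ∧ (0.22)–(0.23) IN THE FINE CURRENCY** over `(𝓡, T)` (a drop-in for the record's `IndA` slot).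
[cite: Balaban1987RG1, (1.1)–(1.3) p.260] -/
def IndAFineRT (𝓡 : RegClass F N) (T : Transport F N) (χ : (K : ℕ) → (ℕ → ℝ) → (k : ℕ) → Density (F.P K) k (SU N)) (ε : ℝ) (β : HBeta)
    (p : B12.RunParams) (k : ℕ) (hist : Fin (k + 1) → ℝ) (dom : Set (GaugeField (F.P p.K) k (SU N)))
    (A W E : GaugeField (F.P p.K) k (SU N) → ℝ) : Prop :=
  (∀ V ∈ dom, UkExistsR F N 𝓡 p.K k ε V ∧ UniqueUkOrbitR F N 𝓡 p.K k ε V) ∧ ReprAFineRT F N 𝓡 T χ ε β p k hist dom A W E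

variable {F N}

/-- **THE TWO CURRENCIES AGREE EXACTLY UNDER THE COMPOSITION INPUT** (at the clamped history `extd hist`).
[cite: Balaban1987RG1, (0.23) p.256 (bookkeeping)] -/
theorem reprAFineRT_iff_reprAOfRecordRT (𝓡 : RegClass F N) (T : Transport F N) (χ : (K : ℕ) → (ℕ → ℝ) → (k : ℕ) → Density (F.P K) k (SU N))
    (ε : ℝ) (β : HBeta) (p : B12.RunParams) (k : ℕ) (hist : Fin (k + 1) → ℝ) (dom : Set (GaugeField (F.P p.K) k (SU N)))
    (A W E : GaugeField (F.P p.K) k (SU N) → ℝ) (hcomp : HCompRT F N 𝓡 T χ ε p.K (extd hist) k dom) :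
    ReprAFineRT F N 𝓡 T χ ε β p k hist dom A W E ↔ ReprAOfRecordRT F N 𝓡 T χ ε β p k hist dom A W E := by
  refine and_congr_right fun _ => forall₂_congr fun V hV => ?_
  rw [Finset.sum_congr rfl fun j hj =>
    congrArg (fun t => -(β j (prefixOf (extd hist) j)) * W V + t)
      ((mergedTermFineT_ukR_eq_mergedTermRT_iff 𝓡 T χ (extd hist) k j ε V).2 (hcomp V hV j (Finset.mem_range.1 hj)))]

/-- (0.22) at the record's objects over `(𝓡, T)`: by `ring`. [cite: Balaban1987RG1, (0.22) p.256] -/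
theorem reprA_fst_atRecordRT (𝓡 : RegClass F N) (T : Transport F N) (χ : (K : ℕ) → (ℕ → ℝ) → (k : ℕ) → Density (F.P K) k (SU N)) (ε : ℝ)
    (β : HBeta) (p : B12.RunParams) (k : ℕ) (dom : Set (GaugeField (F.P p.K) k (SU N))) :
    ∀ V ∈ dom, effActionOfRecordT F N T χ β p k V =
      -(1 / (prefixOf (genSeq β p.g0) k (Fin.last k)) ^ 2) * wilsonBGOfRecordR F N 𝓡 ε p k V + EkOfRecordRT F N 𝓡 T χ ε β p k V := by
  intro V _
  rw [FlowStep.prefixOf_apply, Fin.val_last]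
  unfold EkOfRecordRT
  ring

/-- **(0.23) AT THE RECORD IN THE FINE CURRENCY, over `(𝓡, T)`, FROM χ-LOCALITY + THE FLOW RECURSION + (1.1)-EXISTENCE ALONE** — no composition,
invariance, uniqueness or transport-covariance input.  PRECEDENT BY NAME (not imported, not restated): at ₈a's objects and the run's un-clamped
couplings the identity `EkOfRecordT … = Σ …` is seat dag-n09-a's landed `B12EffectiveActionInvarianceT.repr023_fixedTerm`; here it is the format
PREDICATE `ReprAFineRT` (clamped history `extd (prefixOf g k)`, a domain, a generic class) that is inhabited. [cite: Balaban1987RG1, (0.22)–(0.23) p.256] -/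
theorem reprAFineRT_atRecord (𝓡 : RegClass F N) (T : Transport F N) (χ : (K : ℕ) → (ℕ → ℝ) → (k : ℕ) → Density (F.P K) k (SU N)) (ε : ℝ)
    (β : HBeta) (p : B12.RunParams) (k : ℕ) (dom : Set (GaugeField (F.P p.K) k (SU N)))
    (hχ : ∀ n ≤ k, χ p.K (extd (prefixOf (genSeq β p.g0) k)) n = χ p.K (genSeq β p.g0) n)
    (hflow : RGEqH k β (genSeq β p.g0))
    (hk : ∀ V ∈ dom, UkExistsR F N 𝓡 p.K k ε V) :
    ReprAFineRT F N 𝓡 T χ ε β p k (prefixOf (genSeq β p.g0) k) dom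
      (effActionOfRecordT F N T χ β p k) (wilsonBGOfRecordR F N 𝓡 ε p k) (EkOfRecordRT F N 𝓡 T χ ε β p k) := by
  refine ⟨reprA_fst_atRecordRT 𝓡 T χ ε β p k dom, fun V hV => ?_⟩
  have hg : ∀ n ≤ k, extd (prefixOf (genSeq β p.g0) k) n = genSeq β p.g0 n := fun n hn => extd_prefixOf hn
  have hA : ∀ m ≤ k, effActionHT F N T χ p.K (extd (prefixOf (genSeq β p.g0) k)) m = effActionHT F N T χ p.K (genSeq β p.g0) m :=
    effActionHT_congr T χ hg hχ
  have hsum : ∀ j ∈ Finset.range k,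
      (-(β j (prefixOf (extd (prefixOf (genSeq β p.g0) k)) j)) * wilsonBGOfRecordR F N 𝓡 ε p k V +
        mergedTermFineT F N T χ p.K (extd (prefixOf (genSeq β p.g0) k)) j (UkR F N 𝓡 p.K k ε V)) =
      (-(β j (prefixOf (genSeq β p.g0) j)) * wilsonBGOfRecordR F N 𝓡 ε p k V +
        mergedTermFineT F N T χ p.K (genSeq β p.g0) j (UkR F N 𝓡 p.K k ε V)) := by
    intro j hj
    have hjk : j < k := Finset.mem_range.1 hj
    rw [prefixOf_extd_prefixOf hjk.le]
    unfold mergedTermFineT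
    rw [hA (j + 1) hjk, hA j hjk.le]
  rw [Finset.sum_congr rfl hsum, Finset.sum_add_distrib, sum_mergedTermFineT_ukR 𝓡 T χ (genSeq β p.g0) (hk V hV),
    ← Finset.sum_mul, Finset.sum_neg_distrib, sum_beta_eq_of_rgEqH hflow]
  unfold EkOfRecordRT effActionOfRecordT wilsonBGOfRecordR
  ring

/-- **(1.3) AT THE RECORD IN THE FINE CURRENCY**, with the (1.1) clauses on the domain. [cite: Balaban1987RG1, (1.3) p.260] -/
theorem indAFineRT_atRecord (𝓡 : RegClass F N) (T : Transport F N) (χ : (K : ℕ) → (ℕ → ℝ) → (k : ℕ) → Density (F.P K) k (SU N)) (ε : ℝ)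
    (β : HBeta) (p : B12.RunParams) (k : ℕ) (dom : Set (GaugeField (F.P p.K) k (SU N)))
    (hχ : ∀ n ≤ k, χ p.K (extd (prefixOf (genSeq β p.g0) k)) n = χ p.K (genSeq β p.g0) n)
    (hflow : RGEqH k β (genSeq β p.g0))
    (h11 : ∀ V ∈ dom, UkExistsR F N 𝓡 p.K k ε V ∧ UniqueUkOrbitR F N 𝓡 p.K k ε V) :
    IndAFineRT F N 𝓡 T χ ε β p k (prefixOf (genSeq β p.g0) k) dom
      (effActionOfRecordT F N T χ β p k) (wilsonBGOfRecordR F N 𝓡 ε p k) (EkOfRecordRT F N 𝓡 T χ ε β p k) :=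
  ⟨h11, reprAFineRT_atRecord 𝓡 T χ ε β p k dom hχ hflow fun V hV => (h11 V hV).1⟩

/-- **g-INDEPENDENT χ (print's small-field functions: [I] p.254 «|U(∂p) − 1| < ε₀ … ε₀ positive and sufficiently small», (0.16) p.255,
«the characteristic function χ_k restricts the integral to small fluctuation fields» p.256 — thresholds NOT functions of `g`)**: for a χ-family
constant in the coupling history the locality hypothesis is `rfl`, so (0.23) at the record in the fine currency needs ONLY the flow recursion and
(1.1)-existence on the domain.  (A record binding def-R's `g`-dependent (2.17)-family `chiOfRecord ν g` in this slot owes `hχ` instead.)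
[cite: Balaban1987RG1, (0.16) p.255, (0.22)–(0.23) p.256] -/
theorem reprAFineRT_atRecord_gconst (𝓡 : RegClass F N) (T : Transport F N) (χ₀ : (K k : ℕ) → Density (F.P K) k (SU N)) (ε : ℝ)
    (β : HBeta) (p : B12.RunParams) (k : ℕ) (dom : Set (GaugeField (F.P p.K) k (SU N)))
    (hflow : RGEqH k β (genSeq β p.g0))
    (hk : ∀ V ∈ dom, UkExistsR F N 𝓡 p.K k ε V) :
    ReprAFineRT F N 𝓡 T (fun K _ k => χ₀ K k) ε β p k (prefixOf (genSeq β p.g0) k) dom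
      (effActionOfRecordT F N T (fun K _ k => χ₀ K k) β p k) (wilsonBGOfRecordR F N 𝓡 ε p k)
      (EkOfRecordRT F N 𝓡 T (fun K _ k => χ₀ K k) ε β p k) :=
  reprAFineRT_atRecord 𝓡 T (fun K _ k => χ₀ K k) ε β p k dom (fun _ _ => rfl) hflow hk

/-- **(1.3) AT THE RECORD, fine currency, g-INDEPENDENT χ**: from the flow recursion and the two (1.1) clauses on the domain alone.
[cite: Balaban1987RG1, (1.1)–(1.3) p.260] -/
theorem indAFineRT_atRecord_gconst (𝓡 : RegClass F N) (T : Transport F N) (χ₀ : (K k : ℕ) → Density (F.P K) k (SU N)) (ε : ℝ)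
    (β : HBeta) (p : B12.RunParams) (k : ℕ) (dom : Set (GaugeField (F.P p.K) k (SU N)))
    (hflow : RGEqH k β (genSeq β p.g0))
    (h11 : ∀ V ∈ dom, UkExistsR F N 𝓡 p.K k ε V ∧ UniqueUkOrbitR F N 𝓡 p.K k ε V) :
    IndAFineRT F N 𝓡 T (fun K _ k => χ₀ K k) ε β p k (prefixOf (genSeq β p.g0) k) dom
      (effActionOfRecordT F N T (fun K _ k => χ₀ K k) β p k) (wilsonBGOfRecordR F N 𝓡 ε p k)
      (EkOfRecordRT F N 𝓡 T (fun K _ k => χ₀ K k) ε β p k) :=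
  indAFineRT_atRecord 𝓡 T (fun K _ k => χ₀ K k) ε β p k dom (fun _ _ => rfl) hflow h11

/-- **(0.23) AT THE RECORD IN THE COARSE-DATUM CURRENCY, over `(𝓡, T)`** — as in `BackgroundActionT`, with the composition input `HCompRT` at the
run's couplings. [cite: Balaban1987RG1, (0.22)–(0.23) p.256] -/
theorem reprAOfRecordRT_atRecord (𝓡 : RegClass F N) (T : Transport F N) (χ : (K : ℕ) → (ℕ → ℝ) → (k : ℕ) → Density (F.P K) k (SU N))
    (ε : ℝ) (β : HBeta) (p : B12.RunParams) (k : ℕ) (dom : Set (GaugeField (F.P p.K) k (SU N)))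
    (hχ : ∀ n ≤ k, χ p.K (extd (prefixOf (genSeq β p.g0) k)) n = χ p.K (genSeq β p.g0) n)
    (hflow : RGEqH k β (genSeq β p.g0))
    (hk : ∀ V ∈ dom, UkExistsR F N 𝓡 p.K k ε V)
    (hcomp : HCompRT F N 𝓡 T χ ε p.K (genSeq β p.g0) k dom) :
    ReprAOfRecordRT F N 𝓡 T χ ε β p k (prefixOf (genSeq β p.g0) k) dom
      (effActionOfRecordT F N T χ β p k) (wilsonBGOfRecordR F N 𝓡 ε p k) (EkOfRecordRT F N 𝓡 T χ ε β p k) := by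
  have hg : ∀ n ≤ k, extd (prefixOf (genSeq β p.g0) k) n = genSeq β p.g0 n := fun n hn => extd_prefixOf hn
  have hA : ∀ m ≤ k, effActionHT F N T χ p.K (extd (prefixOf (genSeq β p.g0) k)) m = effActionHT F N T χ p.K (genSeq β p.g0) m :=
    effActionHT_congr T χ hg hχ
  have hcomp' : HCompRT F N 𝓡 T χ ε p.K (extd (prefixOf (genSeq β p.g0) k)) k dom := by
    intro V hV j hj
    rw [hA j hj.le]
    exact hcomp V hV j hj
  exact (reprAFineRT_iff_reprAOfRecordRT 𝓡 T χ ε β p k _ dom _ _ _ hcomp').1 (reprAFineRT_atRecord 𝓡 T χ ε β p k dom hχ hflow hk)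

/-- **(1.3) AT THE RECORD IN THE COARSE-DATUM CURRENCY, over `(𝓡, T)`**. [cite: Balaban1987RG1, (1.3) p.260] -/
theorem indAOfRecordRT_atRecord (𝓡 : RegClass F N) (T : Transport F N) (χ : (K : ℕ) → (ℕ → ℝ) → (k : ℕ) → Density (F.P K) k (SU N))
    (ε : ℝ) (β : HBeta) (p : B12.RunParams) (k : ℕ) (dom : Set (GaugeField (F.P p.K) k (SU N)))
    (hχ : ∀ n ≤ k, χ p.K (extd (prefixOf (genSeq β p.g0) k)) n = χ p.K (genSeq β p.g0) n)
    (hflow : RGEqH k β (genSeq β p.g0))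
    (h11 : ∀ V ∈ dom, UkExistsR F N 𝓡 p.K k ε V ∧ UniqueUkOrbitR F N 𝓡 p.K k ε V)
    (hcomp : HCompRT F N 𝓡 T χ ε p.K (genSeq β p.g0) k dom) :
    IndAOfRecordRT F N 𝓡 T χ ε β p k (prefixOf (genSeq β p.g0) k) dom
      (effActionOfRecordT F N T χ β p k) (wilsonBGOfRecordR F N 𝓡 ε p k) (EkOfRecordRT F N 𝓡 T χ ε β p k) :=
  ⟨h11, reprAOfRecordRT_atRecord 𝓡 T χ ε β p k dom hχ hflow (fun V hV => (h11 V hV).1) hcomp⟩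

end Literature.MathematicalPhysics.QuantumFieldTheory.Balaban1983to89.Node00

end
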